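import Literature.AlgebraicGeometry.Resolution.FiniteNormalizationGRing
import Literature.AlgebraicGeometry.Resolution.ExcellentRingsEssFiniteType
import Literature.AlgebraicGeometry.Resolution.ModelTransport
import Literature.AlgebraicGeometry.Resolution.LocalBlowup
import Literature.RingTheory.KrullDimension.AffineDimension
import Mathlib.RingTheory.DedekindDomain.IntegralClosure
import Mathlib.RingTheory.Ideal.Height
import HarnessLib

/-!
# Local uniformization in dimension one: finite normalization

Topic: `Literature/AlgebraicGeometry/Resolution`. The one-dimensional case of local
uniformization, in the finitely-generated-model form used throughout this topic
(`LocalBlowup.lean`; the conclusion shape of `CossartPiltant2019Local`,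
`ArithmeticalThreefoldsLocal.lean`): for a one-dimensional excellent domain `B` inside its
fraction field `L` and ANY valuation ring `O ⊇ B` of `L` centred at a nonzero prime, some
finitely generated `B[t] ⊆ O` is regular at the centre `𝔪_O ∩ B[t]` — namely `t` a set of
generators of the normalization of the local ring `B_𝔮` (`𝔮` the centre), which is FINITE
because excellent rings are Nagata (here through the tree's `FiniteNormalizationGRing.lean`:
a one-dimensional local G-ring domain has finite normalization, Kollár Thm. 1.101 with Stacks
07QV) and whose local rings are discrete valuation rings (normal of dimension one). This is
the classical remark that resolution, hence local uniformization, of excellent curves is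
normalization (Lipman; Stacks 0BXV "Resolution of one-dimensional (Noetherian, Nagata)
schemes by normalization"); in Cossart–Piltant 2019 it is the trivial bottom case of the
"induction on the dimension of the ambient space" (arXiv v1 p. 58; "One has
`ω(y) = ε(y) = 0` in codimension one") reached by the frames of residually transcendental
valuations.

* `one_le_height_of_ne_bot` — a nonzero ideal of a domain has height `≥ 1`;
* `ringKrullDim_locAtCentre_eq_one` — the local ring `B_𝔮 ⊆ L` at a nonzero centre of a
  domain of dimension `≤ 1` has dimension exactly `1`;
* `exists_closure_isRegularLocalRing_of_ringKrullDim_le_one` — **local uniformization in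
  dimension one**: `B ⊆ O ⊆ L = Frac B`, `B` excellent (Noetherian) of dimension `≤ 1`, the
  centre nonzero ⇒ `B[t] ⊆ O` regular at the centre for some finite `t ⊆ L`;
* `exists_adjoin_isRegularLocalRing_of_ringKrullDim_eq_one` — **the one-dimensional frames of
  Cossart–Piltant's local theorem**: for an excellent local domain `R ⊆ O` of dimension one
  dominated by `O`, `h ∈ R[X]` monic with root `x ∈ L` and `L = Frac(R[x])` ((GEN) of
  `ArithmeticalThreefoldsLocalInField.lean`), some `R[x][t] ⊆ O` is regular at the centre.

Everything is PROVED; no definitions and no named facts are introduced.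

## Sources

* The Stacks Project, Tag 0BXV (normalization resolves Nagata curves), Tag 07QV — background
  for the route; the inputs are the tree's `FiniteNormalizationGRing.lean` (Kollár, *Lectures
  on Resolution of Singularities*, Thm. 1.101) and Matsumura Thm. 11.2 (normal of dimension one
  is regular). [Kollar2007] [Matsumura1987]
* V. Cossart, O. Piltant, J. Algebra 529 (2019) 268–535 = arXiv:1412.0868, Ch. 5 p. 58
  (induction on the dimension; codimension one). [CossartPiltant2019]
-/

noncomputable section

open IsLocalRing Polynomial

namespace Literature.AlgebraicGeometry.Resolution

universe u

/-! ## Heights and the dimension of the local ring at a nonzero centre -/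

section Height

/-- A nonzero ideal of a domain has height `≥ 1`. [folklore] -/
theorem one_le_height_of_ne_bot {B : Type*} [CommRing B] [IsDomain B] {q : Ideal B}
    (hq : q ≠ ⊥) : 1 ≤ q.height :=
  Order.one_le_iff_ne_zero.mpr fun h0 => hq (Ideal.height_eq_zero_iff_eq_bot.mp h0)

/-- Regularity of the localization only depends on the prime ideal (transport along an equality
of ideals). Local copy of the lemma of `JacobianRegularLocus.lean`, kept private to avoid that
import. [folklore] -/
private theorem isRegularLocalRing_atPrime_congr {A : Type*} [CommRing A] {I J : Ideal A}
    [I.IsPrime] [J.IsPrime] (e : I = J) :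
    IsRegularLocalRing (Localization.AtPrime I) ↔ IsRegularLocalRing (Localization.AtPrime J) := by
  subst e
  exact Iff.rfl

end Height

section DimOne

variable {L : Type u} [Field L] (O : ValuationSubring L)

/-- **The local ring at a nonzero centre of a domain of dimension `≤ 1` has dimension one.**
For a subring `B ⊆ O` of `L` with `dim B ≤ 1` and an element `b ∈ B`, `b ≠ 0`, `v(b) < 1`,
the local ring `B_{𝔪_O ∩ B}` (`locAtCentre`, `LocalBlowup.lean`) has Krull dimension `1`.
[folklore] -/
theorem ringKrullDim_locAtCentre_eq_one {B : Subring L} (hBO : B ≤ O.toSubring)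
    (hdim : ringKrullDim B ≤ 1) {b : B} (hb0 : (b : L) ≠ 0) (hvb : O.valuation (b : L) < 1) :
    ringKrullDim (locAtCentre B O) = 1 := by
  set q : Ideal B := subringCentre B O hBO with hq
  haveI : q.IsPrime := subringCentre.isPrime B O hBO
  haveI := isLocalization_locAtCentre hBO
  have hqb : b ∈ q := (mem_subringCentre_iff hBO b).mpr hvb
  have hq0 : q ≠ ⊥ := fun h => hb0 (by
    have : b = 0 := by simpa [h] using hqb
    rw [this]; rfl)
  rw [IsLocalization.AtPrime.ringKrullDim_eq_height q (locAtCentre B O)]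
  have h1 : 1 ≤ q.height := one_le_height_of_ne_bot hq0
  have h2 : (q.height : WithBot ℕ∞) ≤ 1 :=
    (Ideal.height_le_ringKrullDim_of_ne_top (Ideal.IsPrime.ne_top inferInstance)).trans hdim
  exact le_antisymm h2 (by exact_mod_cast h1)

/-- **Local uniformization in dimension one.** Let `B ⊆ O` be a subring of the field `L` with
`Frac B = L`, `B` excellent (in particular Noetherian) of Krull dimension `≤ 1`, `O` a valuation
ring of `L` whose centre on `B` is nonzero (some `0 ≠ b ∈ B` has `v(b) < 1`). Then for some
finite `t ⊆ L` the ring `B[t] ⊆ O` is a regular local ring at the centre `𝔪_O ∩ B[t]`.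
Proof: the local ring `D = B_𝔮` at the centre is a one-dimensional local domain and a G-ring
(excellence localizes), so its normalization `C ⊆ L` is a FINITE `D`-module
(`module_finite_integralClosure_of_isGRing_of_ringKrullDim_eq_one`); `C ⊆ O` (valuation rings are
integrally closed), `C` is a Dedekind domain (Noetherian, normal, of dimension one), hence
regular at every prime; and for `t` a set of `D`-module generators of `C`,
`B[t] ⊆ C ⊆ B[t]_{𝔪_O ∩ B[t]}` (the coefficients from `D` are fractions with `v`-unit
denominators), so `B[t]` and `C` have the same local ring at the centre (`ModelTransport.lean`).
[cite: Kollar2007, Thm. 1.101] [cite: Matsumura1987, Thm. 11.2] -/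
theorem exists_closure_isRegularLocalRing_of_ringKrullDim_le_one (B : Subring L)
    (hexc : IsExcellentRing B) (hdim : ringKrullDim B ≤ 1) (hBO : B ≤ O.toSubring)
    (hfrac : ∀ z : L, ∃ a s : B, (s : L) ≠ 0 ∧ z * s = a)
    {b : B} (hb0 : (b : L) ≠ 0) (hvb : O.valuation (b : L) < 1) :
    ∃ (t : Finset L) (ht : Subring.closure ((B : Set L) ∪ ↑t) ≤ O.toSubring),
      IsRegularLocalRing (Localization.AtPrime (subringCentre (Subring.closure ((B : Set L) ∪ ↑t)) O ht)) := by
  classical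
  haveI : IsNoetherianRing B := hexc.isUniversallyCatenaryRing.1
  -- the local ring `D = B_𝔮` at the centre
  set D : Subring L := locAtCentre B O with hD
  have hBD : B ≤ D := le_locAtCentre B O
  have hDO : D ≤ O.toSubring := locAtCentre_le hBO
  haveI : IsLocalRing D := isLocalRing_locAtCentre hBO
  haveI := isLocalization_locAtCentre hBO
  haveI : IsNoetherianRing D :=
    IsLocalization.isNoetherianRing (subringCentre B O hBO).primeCompl _ inferInstance
  have hexcD : IsExcellentRing D := hexc.of_isLocalization (subringCentre B O hBO).primeCompl
  have hdimD : ringKrullDim D = 1 := ringKrullDim_locAtCentre_eq_one O hBO hdim hb0 hvb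
  -- `Frac D = L`
  haveI : IsFractionRing D L := by
    refine IsFractionRing.of_field D L fun z => ?_
    obtain ⟨a, s, hs, hz⟩ := hfrac z
    refine ⟨⟨a, hBD a.2⟩, ⟨s, hBD s.2⟩, ?_⟩
    change z = (a : L) / (s : L)
    rw [eq_div_iff hs]
    exact hz
  -- the normalization `C` of `D` in `L` is finite over `D`
  have hfin0 : Module.Finite D (integralClosure D (FractionRing D)) :=
    module_finite_integralClosure_of_isGRing_of_ringKrullDim_eq_one D
      hexcD.isQuasiExcellentRing.isGRing hdimD
  set C : Subalgebra D L := integralClosure D L with hC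
  let e : FractionRing D ≃ₐ[D] L := FractionRing.algEquiv D L
  have hCmap : (integralClosure D (FractionRing D)).map (e : FractionRing D →ₐ[D] L) = C := by
    rw [hC, ← integralClosure_map_algEquiv e]
  haveI hfinC : Module.Finite D C := by
    haveI := hfin0
    have hfin1 : Module.Finite D ((integralClosure D (FractionRing D)).map (e : FractionRing D →ₐ[D] L)) :=
      Module.Finite.equiv (e.subalgebraMap (integralClosure D (FractionRing D))).toLinearEquiv
    rw [hCmap] at hfin1
    exact hfin1
  -- `C ⊆ O`
  have hCO : ∀ y : C, (y : L) ∈ O := by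
    intro y
    letI : Algebra D O := ((algebraMap D L).codRestrict O.toSubring fun d => hDO d.2).toAlgebra
    haveI : IsScalarTower D O L := IsScalarTower.of_algebraMap_eq fun _ => rfl
    have hint : IsIntegral D (y : L) := y.2
    obtain ⟨w, hw⟩ := IsIntegrallyClosed.algebraMap_eq_of_integral (IsIntegral.tower_top (A := O) hint)
    rw [← hw]
    exact w.2
  -- `C` is a Dedekind domain, hence regular at every prime
  haveI : IsNoetherianRing C := isNoetherian_of_tower D (isNoetherian_of_isNoetherianRing_of_finite D C)
  haveI : IsFractionRing C L := by
    refine IsFractionRing.of_field C L fun z => ?_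
    obtain ⟨a, s, hs, hz⟩ := hfrac z
    refine ⟨algebraMap D C ⟨a, hBD a.2⟩, algebraMap D C ⟨s, hBD s.2⟩, ?_⟩
    rw [← IsScalarTower.algebraMap_apply, ← IsScalarTower.algebraMap_apply]
    change z = (a : L) / (s : L)
    rw [eq_div_iff hs]
    exact hz
  haveI : IsIntegrallyClosed C := (isIntegrallyClosed_iff_isIntegrallyClosedIn L).mpr inferInstance
  have hdimC : ringKrullDim C ≤ 1 := by
    rw [ringKrullDim_eq_of_isIntegral (R := D) (S := C)
      (fun a b hab => Subtype.ext (congrArg (Subtype.val : C → L) hab))]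
    exact hdimD.le
  haveI : Ring.KrullDimLE 1 C := Ring.krullDimLE_iff.mpr hdimC
  haveI : Ring.DimensionLEOne C := ⟨fun hne hp => hp.isMaximal_of_ne_bot hne⟩
  haveI : IsDedekindDomain C := { }
  -- generators of `C` over `D`
  obtain ⟨s, hs⟩ := Module.finite_def.mp hfinC
  let t : Finset L := s.image fun y : C => (y : L)
  set T : Subring L := Subring.closure ((B : Set L) ∪ ↑t) with hT
  -- `T ⊆ C ⊆ O`
  have hTC : T ≤ C.toSubring := by
    refine Subring.closure_le.mpr ?_
    rintro y (hy | hy)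
    · exact Subalgebra.algebraMap_mem C (⟨y, hBD hy⟩ : D)
    · obtain ⟨c, -, rfl⟩ := Finset.mem_image.mp hy
      exact c.2
  have hTO : T ≤ O.toSubring := fun y hy => hCO ⟨y, hTC hy⟩
  refine ⟨t, hTO, ?_⟩
  have hBT : B ≤ T := fun y hy => Subring.subset_closure (Or.inl hy)
  have htT : ∀ y ∈ s, ((y : C) : L) ∈ T := fun y hy =>
    Subring.subset_closure (Or.inr (Finset.mem_image_of_mem _ hy))
  -- sandwich: every element of `C` is `a/w` with `a, w ∈ T`, `v(w) = 1`
  have H : ∀ c : C, ∃ a ∈ T, ∃ w ∈ T, O.valuation w = 1 ∧ (c : L) * w = a := by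
    intro c
    have hc : c ∈ Submodule.span D (s : Set C) := by rw [hs]; exact Submodule.mem_top
    induction hc using Submodule.span_induction with
    | mem y hy => exact ⟨y, htT y hy, 1, Subring.one_mem _, by simp, by simp⟩
    | zero => exact ⟨0, Subring.zero_mem _, 1, Subring.one_mem _, by simp, by simp⟩
    | add y z _ _ hy hz =>
      obtain ⟨a, ha, w, hw, hvw, hyw⟩ := hy
      obtain ⟨a', ha', w', hw', hvw', hzw⟩ := hz
      refine ⟨a * w' + a' * w, Subring.add_mem _ (Subring.mul_mem _ ha hw') (Subring.mul_mem _ ha' hw),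
        w * w', Subring.mul_mem _ hw hw', by rw [map_mul, hvw, hvw', mul_one], ?_⟩
      rw [Subalgebra.coe_add, ← hyw, ← hzw]; ring
    | smul d y _ hy =>
      obtain ⟨a, ha, w, hw, hvw, hyw⟩ := hy
      obtain ⟨b', hb', w', hw', hvw', hd⟩ := (mem_locAtCentre_iff).mp d.2
      refine ⟨b' * a, Subring.mul_mem _ (hBT hb') ha, w' * w, Subring.mul_mem _ (hBT hw') hw,
        by rw [map_mul, hvw, hvw', mul_one], ?_⟩
      rw [Subalgebra.coe_smul, Algebra.smul_def, ← hyw]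
      change ((d : D) : L) * (y : L) * (w' * w) = b' * ((y : L) * w)
      rw [hd, div_mul_eq_mul_div, ← mul_assoc]
      field_simp [ne_zero_of_valuation_eq_one hvw']
  -- apply the abstract sandwich
  let f : T →+* C.toSubring := Subring.inclusion hTC
  have hinj : Function.Injective f := Subring.inclusion_injective hTC
  have hCO' : C.toSubring ≤ O.toSubring := fun y hy => hCO ⟨y, hy⟩
  set P : Ideal C.toSubring := Ideal.comap (Subring.inclusion hCO') (maximalIdeal O) with hP
  haveI : P.IsPrime := Ideal.IsPrime.comap _
  have hPmem : ∀ z : C.toSubring, z ∈ P ↔ O.valuation (z : L) < 1 := fun z => by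
    rw [hP, Ideal.mem_comap, ValuationSubring.valuation_lt_one_iff]; rfl
  have H' : ∀ z : C.toSubring, ∃ a w : T, f w ∉ P ∧ z * f w = f a := by
    intro z
    obtain ⟨a, ha, w, hw, hvw, hzw⟩ := H ⟨z, z.2⟩
    refine ⟨⟨a, ha⟩, ⟨w, hw⟩, ?_, Subtype.ext hzw⟩
    rw [hPmem]
    change ¬ O.valuation w < 1
    rw [hvw]; exact lt_irrefl 1
  -- `C_P` is regular: `P` is a prime of the Dedekind domain `C`
  have hregC : IsRegularLocalRing (Localization.AtPrime P) :=
    IsRegularRing.isRegularLocalRing_localization (R := C) P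
  have key := (isRegularLocalRing_localization_comap_iff_of_sandwich f hinj P H').mpr hregC
  have hcomap : P.comap f = subringCentre T O hTO := by
    rw [hP, Ideal.comap_comap]
    rfl
  exact (isRegularLocalRing_atPrime_congr hcomap).mp key

/-- **The one-dimensional frames of Cossart–Piltant's local theorem.** Let `R ⊆ O` be a local
subring of `L`, excellent of Krull dimension one (a domain), dominated by the valuation ring `O`,
`h ∈ R[X]` monic with a root `x ∈ L` such that `L = Frac(R[x])` (every `z ∈ L` has
`z·s = g(x)`, `g ∈ R[X]`, `0 ≠ s ∈ R` — (GEN) of `ArithmeticalThreefoldsLocalInField.lean`). Then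
some finitely generated `R[x][t] ⊆ O` is a regular local ring at the centre `𝔪_O ∩ R[x][t]`:
`R[x]` is excellent of dimension one with fraction field `L`
(`exists_closure_isRegularLocalRing_of_ringKrullDim_le_one`). No hypothesis on the degree of `h`,
on `Aut(L)` or on the residue field of `O` is needed in dimension one.
[cite: CossartPiltant2019, Ch. 5 p. 58 (arXiv v1; codimension one)] -/
theorem exists_adjoin_isRegularLocalRing_of_ringKrullDim_eq_one {R : Subring L} [IsLocalRing R]
    (hexc : IsExcellentRing R) (hdim : ringKrullDim R = 1) (hRO : R ≤ O.toSubring)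
    (hdom : ∀ r : R, r ∈ maximalIdeal R → O.valuation (r : L) < 1)
    {h : R[X]} (hmon : h.Monic) {x : L} (hx : aeval x h = 0)
    (hgen : ∀ z : L, ∃ (g : R[X]) (s : R), s ≠ 0 ∧ z * s = aeval x g) :
    ∃ (t : Finset L) (ht : (Algebra.adjoin R (insert x (t : Set L))).toSubring ≤ O.toSubring),
      IsRegularLocalRing (Localization.AtPrime
        (Ideal.comap (Subring.inclusion ht) (maximalIdeal O))) := by
  classical
  haveI : IsNoetherianRing R := hexc.isUniversallyCatenaryRing.1
  set A : Subalgebra R L := Algebra.adjoin R ({x} : Set L) with hA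
  -- `R[x]` is finite type, integral over `R`, excellent, of dimension one
  haveI : Algebra.FiniteType R A := by
    rw [← Subalgebra.fg_iff_finiteType, hA, ← Finset.coe_singleton]
    exact Subalgebra.fg_adjoin_finset _
  have hint : IsIntegral R x := ⟨h, hmon, by rwa [← aeval_def]⟩
  haveI : Algebra.IsIntegral R A := Algebra.IsIntegral.adjoin fun y hy => by
    rw [Set.mem_singleton_iff] at hy
    rw [hy]; exact hint
  have hexcA : IsExcellentRing A := hexc.of_finiteType'
  have hdimA : ringKrullDim A ≤ 1 := by
    rw [ringKrullDim_eq_of_isIntegral (R := R) (S := A)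
      (fun a b hab => Subtype.ext (congrArg (Subtype.val : A → L) hab)), hdim]
  -- `R[x] ⊆ O`
  have hO : ∀ r : R, (r : L) ∈ O := fun r => hRO r.2
  have hxO : x ∈ O := by
    letI : Algebra R O := ((algebraMap R L).codRestrict O.toSubring fun r => hO r).toAlgebra
    haveI : IsScalarTower R O L := IsScalarTower.of_algebraMap_eq fun _ => rfl
    obtain ⟨y, hy⟩ := IsIntegrallyClosed.algebraMap_eq_of_integral (IsIntegral.tower_top (A := O) hint)
    rw [← hy]
    exact y.2
  have hAO : A.toSubring ≤ O.toSubring := by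
    rw [hA, Algebra.adjoin_eq_ring_closure]
    refine Subring.closure_le.mpr (Set.union_subset ?_ (Set.singleton_subset_iff.mpr hxO))
    rintro _ ⟨r, rfl⟩
    exact hO r
  -- `Frac R[x] = L`
  have hfrac : ∀ z : L, ∃ a s : A.toSubring, (s : L) ≠ 0 ∧ z * s = a := by
    intro z
    obtain ⟨g, s, hs, hz⟩ := hgen z
    refine ⟨⟨aeval x g, Polynomial.aeval_mem_adjoin_singleton R x⟩, ⟨s, A.algebraMap_mem s⟩,
      fun h0 => hs (Subtype.ext h0), hz⟩
  -- the centre is nonzero: `𝔪_R ≠ 0` as `dim R = 1`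
  have hm : maximalIdeal R ≠ ⊥ := fun hbot => by
    have h0 := ringKrullDim_eq_zero_of_isField (IsLocalRing.isField_iff_maximalIdeal_eq.mpr hbot)
    rw [hdim] at h0
    exact one_ne_zero h0
  obtain ⟨c, hcm, hc0⟩ : ∃ c ∈ maximalIdeal R, c ≠ 0 := by
    by_contra! hcon
    exact hm ((Submodule.eq_bot_iff _).mpr hcon)
  have hc0' : ((⟨(c : L), A.algebraMap_mem c⟩ : A.toSubring) : L) ≠ 0 :=
    fun h0 => hc0 (Subtype.ext h0)
  obtain ⟨t, ht, hreg⟩ := exists_closure_isRegularLocalRing_of_ringKrullDim_le_one O A.toSubring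
    hexcA hdimA hAO hfrac hc0' (hdom c hcm)
  -- `R[x][t] = closure (R[x] ∪ t)`
  have heq : (Algebra.adjoin R (insert x (t : Set L))).toSubring =
      Subring.closure ((A.toSubring : Set L) ∪ ↑t) := by
    rw [Algebra.adjoin_eq_ring_closure, hA, Algebra.adjoin_eq_ring_closure]
    apply le_antisymm
    · refine Subring.closure_le.mpr ?_
      rintro y (hy | hy)
      · exact Subring.subset_closure (Or.inl (Subring.subset_closure (Or.inl hy)))
      · rcases Set.mem_insert_iff.mp hy with rfl | hy
        · exact Subring.subset_closure (Or.inl (Subring.subset_closure (Or.inr rfl)))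
        · exact Subring.subset_closure (Or.inr hy)
    · refine Subring.closure_le.mpr (Set.union_subset (Subring.closure_le.mpr ?_) ?_)
      · rintro y (hy | hy)
        · exact Subring.subset_closure (Or.inl hy)
        · exact Subring.subset_closure (Or.inr (Set.mem_insert_iff.mpr (Or.inl hy)))
      · exact fun y hy => Subring.subset_closure (Or.inr (Set.mem_insert_of_mem _ hy))
  have ht' : (Algebra.adjoin R (insert x (t : Set L))).toSubring ≤ O.toSubring :=
    (le_of_eq heq).trans ht
  exact ⟨t, ht', (isRegularLocalRing_centre_congr heq ht' ht).mpr hreg⟩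

end DimOne

end Literature.AlgebraicGeometry.Resolution

end
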